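import Summits.CriticalPhenomena.CardyFormulaZ2.Theorems.CardyIKTransportIKLinearTransportLine
import Literature.Probability.Percolation.CornerPercolation
import Literature.Probability.RandomPlanarGeometry.MarkedDomainCorners

/-!
# Stub `stub_CouplingToLimits` (line `pinned-diagram-exchange`, crux `CardyIKTransport.IKLinearTransport`,
# stmt-CriticalPhenomena-5076) — part 3: events, paths and couplings of the column-mixed gauge

Support file (`--supports stmt-CriticalPhenomena-5076`): the model-side plumbing of the sandwich argument.

* measurability: `obs S`, `blackEdges` and the crude crossing events
  `{ω | blackEdges (obs S ω) ∈ embDomainCrossing sqEmb Ω δ A B}` are measurable (`measurableSet_crudeEvent`);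
  `μIK` is a probability measure (`isProbabilityMeasure_μIK`, a theorem — use `haveI`);
* the COUPLING INEQUALITY (`real_le_of_coupling_fst` / `_snd`): if `γ` has marginals `μIK`, `γ B ≤ ε`, and
  `E × Ω ∖ B ⊆ Ω × F` pointwise, then `μIK E ≤ ε + μIK F` (only `E` need be measurable, `Measure.le_map_apply`);
* paths: an open crossing in `blackEdges x` is a nonempty `cellGraph`-chain of black cells (`monoPaths`) and
  conversely (`exists_chain_of_mem_openConnIn`, `mem_openConnIn_of_isChain`); adjacent cells are `≤ 2δ` apart
  after rescaling (`dist_pos_le_of_adj`);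
* arcs: `arc 0` and `arc 2` of a conformal rectangle are at positive distance (`exists_pos_le_dist_arc_zero_two`).
-/

noncomputable section

namespace Summit.CriticalPhenomena.CardyFormulaZ2.Theorems.IKLinearTransport.PinnedDiagramExchange

open scoped BigOperators Topology Classical MeasureTheory ProbabilityTheory ENNReal
open Filter Set Function MeasureTheory
open Literature.Probability.Percolation Literature.Probability.LatticeModels
open Literature.Probability.RandomPlanarGeometry

namespace CouplingToLimits

/-! ## The gauge measure is a probability measure -/

/-- `μIK` is a probability measure (product of five Bernoulli product measures). [folklore] -/
theorem isProbabilityMeasure_μIK : IsProbabilityMeasure μIK := by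
  unfold μIK; infer_instance

/-! ## Measurability -/

section Measurability

variable {X : Type*} [MeasurableSpace X]

/-- `Xor` of two measurable propositions is measurable. [folklore] -/
theorem measurable_xor {p q : X → Prop} (hp : Measurable p) (hq : Measurable q) :
    Measurable fun a => Xor (p a) (q a) :=
  show Measurable fun a => (p a ∧ ¬ q a) ∨ (q a ∧ ¬ p a) from (hp.and hq.not).or (hq.and hp.not)

/-- The number of elements of a fixed finite set passing a pointwise-measurable test is measurable. [folklore] -/
theorem measurable_card_filter {ι : Type*} (s : Finset ι) {p : X → ι → Prop}
    [∀ a i, Decidable (p a i)] (hp : ∀ i, Measurable fun a => p a i) :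
    Measurable fun a => (s.filter (p a)).card := by
  induction s using Finset.induction_on with
  | empty => simp
  | insert i s hi ih =>
    have hfun : (fun a => ((insert i s).filter (p a)).card) =
        fun a => if p a i then (s.filter (p a)).card + 1 else (s.filter (p a)).card := by
      funext a
      rw [Finset.filter_insert]
      split_ifs with h
      · rw [Finset.card_insert_of_notMem]
        exact fun h' => hi (Finset.mem_filter.1 h').1
      · rfl
    rw [hfun]
    exact Measurable.ite (measurableSet_setOf.2 (hp i))
      ((measurable_of_countable fun n : ℕ => n + 1).comp ih) ih

/-- Membership of a face in the plaquette-parity set is a measurable event. [folklore] -/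
theorem measurable_mem_parSet (S : Set ℤ) (f : Site 2) : Measurable fun ω : Ω => f ∈ parSet S ω := by
  simp only [parSet, Set.mem_setOf_eq]
  have h1 : Measurable fun ω : Ω => f ∈ ω.2.2.1 :=
    (measurable_set_mem f).comp (measurable_fst.comp (measurable_snd.comp measurable_snd))
  have h2 : Measurable fun ω : Ω => f ∈ ω.2.2.2.1 :=
    (measurable_set_mem f).comp
      (measurable_fst.comp (measurable_snd.comp (measurable_snd.comp measurable_snd)))
  exact (measurable_const.and h1).or (measurable_const.and h2)

/-- The colour of a cell is a measurable event. [folklore] -/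
theorem measurable_mem_blackSet (S : Set ℤ) (v : Site 2) : Measurable fun ω : Ω => v ∈ blackSet S ω := by
  simp only [blackSet, Set.mem_setOf_eq]
  have h1 : Measurable fun ω : Ω => v 0 ∈ ω.1 := (measurable_set_mem (v 0)).comp measurable_fst
  have h2 : Measurable fun ω : Ω => v 1 ∈ ω.2.1 :=
    (measurable_set_mem (v 1)).comp (measurable_fst.comp measurable_snd)
  have h3 : Measurable fun ω : Ω => Odd ((Finset.filter (fun f : ℤ × ℤ => ![f.1, f.2] ∈ parSet S ω)
      (Finset.Ico (min 0 (v 0)) (max 0 (v 0)) ×ˢ Finset.Ico (min 0 (v 1)) (max 0 (v 1)))).card) :=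
    (measurable_of_countable fun n : ℕ => Odd n).comp
      (measurable_card_filter _ fun f => measurable_mem_parSet S _)
  exact measurable_xor h1 (measurable_xor h2 h3)

/-- The anti-diagonal flag of a face is a measurable event. [folklore] -/
theorem measurable_mem_antiSet (S : Set ℤ) (f : Site 2) : Measurable fun ω : Ω => f ∈ antiSet S ω := by
  simp only [antiSet, Set.mem_setOf_eq]
  exact measurable_const.or ((measurable_set_mem f).comp
    (measurable_snd.comp (measurable_snd.comp (measurable_snd.comp measurable_snd))))

/-- The observable configuration is a measurable function of the bits. [folklore] -/
theorem measurable_obs (S : Set ℤ) : Measurable (obs S) :=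
  (measurable_set_iff.2 (measurable_mem_blackSet S)).prodMk (measurable_set_iff.2 (measurable_mem_antiSet S))

/-- The edge relation of `blackEdges`, as a measurable predicate of the observables. [folklore] -/
theorem measurable_edgeRel (u v : Site 2) : Measurable fun x : Obs =>
    u ∈ x.1 ∧ v ∈ x.1 ∧ (v = u + ![1, 0] ∨ v = u + ![0, 1] ∨ (v = u + ![1, 1] ∧ ¬ u ∈ x.2) ∨
      (v = u + ![1, -1] ∧ (u + ![0, -1]) ∈ x.2)) := by
  have hu : Measurable fun x : Obs => u ∈ x.1 := (measurable_set_mem u).comp measurable_fst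
  have hv : Measurable fun x : Obs => v ∈ x.1 := (measurable_set_mem v).comp measurable_fst
  have hu2 : Measurable fun x : Obs => u ∈ x.2 := (measurable_set_mem u).comp measurable_snd
  have hu3 : Measurable fun x : Obs => (u + ![0, -1]) ∈ x.2 := (measurable_set_mem _).comp measurable_snd
  exact hu.and (hv.and (measurable_const.or (measurable_const.or
    ((measurable_const.and hu2.not).or (measurable_const.and hu3)))))

/-- Membership of a given edge in `blackEdges x`, unfolded. [folklore] -/
theorem mk_mem_blackEdges_iff (x : Obs) (u v : Site 2) :
    s(u, v) ∈ blackEdges x ↔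
      (u ∈ x.1 ∧ v ∈ x.1 ∧ (v = u + ![1, 0] ∨ v = u + ![0, 1] ∨ (v = u + ![1, 1] ∧ ¬ u ∈ x.2) ∨
        (v = u + ![1, -1] ∧ (u + ![0, -1]) ∈ x.2))) ∨
      (v ∈ x.1 ∧ u ∈ x.1 ∧ (u = v + ![1, 0] ∨ u = v + ![0, 1] ∨ (u = v + ![1, 1] ∧ ¬ v ∈ x.2) ∨
        (u = v + ![1, -1] ∧ (v + ![0, -1]) ∈ x.2))) := by
  simp only [blackEdges, Set.mem_setOf_eq]
  constructor
  · rintro ⟨a, b, hab, ha, hb, h⟩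
    rcases Sym2.eq_iff.1 hab with ⟨rfl, rfl⟩ | ⟨rfl, rfl⟩
    · exact Or.inl ⟨ha, hb, h⟩
    · exact Or.inr ⟨ha, hb, h⟩
  · rintro (⟨hu, hv, h⟩ | ⟨hv, hu, h⟩)
    · exact ⟨u, v, rfl, hu, hv, h⟩
    · exact ⟨v, u, Sym2.eq_swap, hv, hu, h⟩

/-- `blackEdges` is a measurable function of the observables. [folklore] -/
theorem measurable_blackEdges : Measurable blackEdges := by
  refine measurable_set_iff.2 fun e => ?_
  induction e using Sym2.ind with
  | h u v =>
    simp_rw [mk_mem_blackEdges_iff]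
    exact (measurable_edgeRel u v).or (measurable_edgeRel v u)

/-- The crude crossing event of the `S`-mixed model is measurable. [folklore] -/
theorem measurableSet_crudeEvent (S : Set ℤ) (D : Set ℂ) (δ : ℝ) (A B : Set ℂ) :
    MeasurableSet {ω : Ω | blackEdges (obs S ω) ∈ embDomainCrossing sqEmb D δ A B} :=
  (measurable_blackEdges.comp (measurable_obs S)) (measurableSet_embDomainCrossing sqEmb D δ A B)

end Measurability

/-! ## The coupling inequality -/

/-- COUPLING INEQUALITY, first marginal: if `γ` couples `μIK` with itself, `γ B ≤ ε`, and off `B` the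
event `E` of the first coordinate forces the event `F` of the second, then `μIK E ≤ ε + μIK F`
(only `E` needs to be measurable). [folklore] -/
theorem real_le_of_coupling_fst {γ : Measure (Ω × Ω)} (h1 : γ.map Prod.fst = μIK)
    (h2 : γ.map Prod.snd = μIK) {B : Set (Ω × Ω)} {ε : ℝ} (hε : 0 ≤ ε) (hB : γ B ≤ ENNReal.ofReal ε)
    {E F : Set Ω} (hE : MeasurableSet E) (hincl : ∀ p : Ω × Ω, p.1 ∈ E → p ∉ B → p.2 ∈ F) :
    μIK.real E ≤ ε + μIK.real F := by
  haveI := isProbabilityMeasure_μIK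
  have hγE : μIK E = γ (Prod.fst ⁻¹' E) := by rw [← h1, Measure.map_apply measurable_fst hE]
  have hsub : Prod.fst ⁻¹' E ⊆ B ∪ Prod.snd ⁻¹' F := fun p hp => by
    by_cases hb : p ∈ B
    · exact Or.inl hb
    · exact Or.inr (hincl p hp hb)
  have hF : γ (Prod.snd ⁻¹' F) ≤ μIK F := by
    rw [← h2]; exact Measure.le_map_apply measurable_snd.aemeasurable F
  have hle : μIK E ≤ ENNReal.ofReal ε + μIK F := by
    rw [hγE]; exact (measure_mono hsub).trans ((measure_union_le _ _).trans (add_le_add hB hF))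
  have hfin : μIK F ≠ ⊤ := measure_ne_top _ _
  calc μIK.real E = (μIK E).toReal := rfl
    _ ≤ (ENNReal.ofReal ε + μIK F).toReal := ENNReal.toReal_mono (by simp [hfin]) hle
    _ = ε + μIK.real F := by
        rw [ENNReal.toReal_add ENNReal.ofReal_ne_top hfin, ENNReal.toReal_ofReal hε]; rfl

/-- COUPLING INEQUALITY, second marginal. [folklore] -/
theorem real_le_of_coupling_snd {γ : Measure (Ω × Ω)} (h1 : γ.map Prod.fst = μIK)
    (h2 : γ.map Prod.snd = μIK) {B : Set (Ω × Ω)} {ε : ℝ} (hε : 0 ≤ ε) (hB : γ B ≤ ENNReal.ofReal ε)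
    {E F : Set Ω} (hE : MeasurableSet E) (hincl : ∀ p : Ω × Ω, p.2 ∈ E → p ∉ B → p.1 ∈ F) :
    μIK.real E ≤ ε + μIK.real F := by
  haveI := isProbabilityMeasure_μIK
  have hγE : μIK E = γ (Prod.snd ⁻¹' E) := by rw [← h2, Measure.map_apply measurable_snd hE]
  have hsub : Prod.snd ⁻¹' E ⊆ B ∪ Prod.fst ⁻¹' F := fun p hp => by
    by_cases hb : p ∈ B
    · exact Or.inl hb
    · exact Or.inr (hincl p hp hb)
  have hF : γ (Prod.fst ⁻¹' F) ≤ μIK F := by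
    rw [← h1]; exact Measure.le_map_apply measurable_fst.aemeasurable F
  have hle : μIK E ≤ ENNReal.ofReal ε + μIK F := by
    rw [hγE]; exact (measure_mono hsub).trans ((measure_union_le _ _).trans (add_le_add hB hF))
  have hfin : μIK F ≠ ⊤ := measure_ne_top _ _
  calc μIK.real E = (μIK E).toReal := rfl
    _ ≤ (ENNReal.ofReal ε + μIK F).toReal := ENNReal.toReal_mono (by simp [hfin]) hle
    _ = ε + μIK.real F := by
        rw [ENNReal.toReal_add ENNReal.ofReal_ne_top hfin, ENNReal.toReal_ofReal hε]; rfl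

/-! ## Edges, adjacency and paths -/

/-- The four lattice steps are nonzero. [folklore] -/
theorem add_step_ne (u : Site 2) :
    u + ![1, 0] ≠ u ∧ u + ![0, 1] ≠ u ∧ u + ![1, 1] ≠ u ∧ u + ![1, -1] ≠ u := by
  refine ⟨fun h => ?_, fun h => ?_, fun h => ?_, fun h => ?_⟩
  · have := congrFun h 0; simp at this
  · have := congrFun h 1; simp at this
  · have := congrFun h 0; simp at this
  · have := congrFun h 0; simp at this

/-- An edge of `blackEdges x` joins two black `cellGraph x.2`-neighbours. [folklore] -/
theorem adj_of_mk_mem_blackEdges {x : Obs} {u v : Site 2} (h : s(u, v) ∈ blackEdges x) :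
    (cellGraph x.2).Adj u v ∧ u ∈ x.1 ∧ v ∈ x.1 := by
  have hne : ∀ a b : Site 2, (b = a + ![1, 0] ∨ b = a + ![0, 1] ∨ (b = a + ![1, 1] ∧ ¬ a ∈ x.2) ∨
      (b = a + ![1, -1] ∧ (a + ![0, -1]) ∈ x.2)) → a ≠ b := by
    rintro a b hr rfl
    obtain ⟨h1, h2, h3, h4⟩ := add_step_ne a
    rcases hr with h | h | ⟨h, -⟩ | ⟨h, -⟩
    · exact h1 h.symm
    · exact h2 h.symm
    · exact h3 h.symm
    · exact h4 h.symm
  rcases (mk_mem_blackEdges_iff x u v).1 h with ⟨hu, hv, hr⟩ | ⟨hv, hu, hr⟩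
  · exact ⟨(SimpleGraph.fromRel_adj _ _ _).2 ⟨hne u v hr, Or.inl hr⟩, hu, hv⟩
  · exact ⟨(SimpleGraph.fromRel_adj _ _ _).2 ⟨(hne v u hr).symm, Or.inr hr⟩, hu, hv⟩

/-- Two black `cellGraph x.2`-neighbours span an edge of `blackEdges x`. [folklore] -/
theorem mk_mem_blackEdges_of_adj {x : Obs} {u v : Site 2} (h : (cellGraph x.2).Adj u v)
    (hu : u ∈ x.1) (hv : v ∈ x.1) : s(u, v) ∈ blackEdges x := by
  obtain ⟨-, hr | hr⟩ := (SimpleGraph.fromRel_adj _ _ _).1 h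
  · exact (mk_mem_blackEdges_iff x u v).2 (Or.inl ⟨hu, hv, hr⟩)
  · exact (mk_mem_blackEdges_iff x u v).2 (Or.inr ⟨hv, hu, hr⟩)

/-- In a chain of length `≥ 2` for a relation forcing `P` at both ends, every element satisfies `P`.
[folklore] -/
theorem forall_mem_of_isChain {α : Type*} {T : α → α → Prop} {P : α → Prop}
    (hT : ∀ a b, T a b → P a ∧ P b) : ∀ (a b : α) (l : List α), List.IsChain T (a :: b :: l) →
    ∀ c ∈ a :: b :: l, P c
  | a, b, [], h, c, hc => by
    have hab : T a b := (List.isChain_cons_cons.1 h).1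
    simp only [List.mem_cons, List.not_mem_nil, or_false] at hc
    rcases hc with rfl | rfl
    · exact (hT _ _ hab).1
    · exact (hT _ _ hab).2
  | a, b, d :: l, h, c, hc => by
    have hab : T a b := (List.isChain_cons_cons.1 h).1
    rcases List.mem_cons.1 hc with rfl | hc
    · exact (hT _ _ hab).1
    · exact forall_mem_of_isChain hT b d l (List.isChain_cons_cons.1 h).2 c hc

/-- FROM AN OPEN CROSSING TO A MONOCHROMATIC CHAIN: an open path of `blackEdges x` inside `S` between two
distinct cells is traced by a `cellGraph x.2`-chain of black cells of `S` with the same ends. [folklore] -/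
theorem exists_chain_of_mem_openConnIn {x : Obs} {S : Set (Site 2)} {u v : Site 2}
    (h : blackEdges x ∈ openConnIn S u v) (huv : u ≠ v) :
    ∃ l : List (Site 2), l.head? = some u ∧ l.getLast? = some v ∧ List.IsChain (cellGraph x.2).Adj l ∧
      (∀ w ∈ l, w ∈ x.1) ∧ (∀ w ∈ l, w ∈ S) := by
  obtain ⟨hu, hv, ⟨W⟩⟩ := h
  set l : List (Site 2) := W.support.map Subtype.val with hl
  have hT : List.IsChain (fun a b : Site 2 => (cellGraph x.2).Adj a b ∧ a ∈ x.1 ∧ b ∈ x.1) l := by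
    rw [hl, List.isChain_map]
    refine List.IsChain.imp (fun a b hab => ?_) W.isChain_adj_support
    have hab' : (openGraph (blackEdges x)).Adj a.1 b.1 := hab
    exact adj_of_mk_mem_blackEdges ((openGraph_adj _ _ _).1 hab').1
  have hhead : l.head? = some u := by rw [hl, ← W.cons_tail_support]; rfl
  have hlast : l.getLast? = some v := by
    rw [hl, List.getLast?_eq_some_getLast (by rw [ne_eq, List.map_eq_nil_iff]; exact W.support_ne_nil),
      List.getLast_map, W.getLast_support]
  refine ⟨l, hhead, hlast, hT.imp fun a b h => h.1, ?_, fun w hw => ?_⟩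
  · -- all cells are black: the chain has at least two cells since `u ≠ v`
    obtain ⟨a, t, hat⟩ := List.exists_cons_of_ne_nil (l := l)
      (by rw [hl, ne_eq, List.map_eq_nil_iff]; exact W.support_ne_nil)
    obtain ⟨b, t', rfl⟩ : ∃ b t', t = b :: t' := by
      cases t with
      | nil =>
        exfalso
        rw [hat] at hhead hlast
        simp only [List.head?_cons, Option.some.injEq, List.getLast?_singleton] at hhead hlast
        exact huv (hhead.symm.trans hlast)
      | cons b t' => exact ⟨b, t', rfl⟩
    rw [hat] at hT ⊢
    exact forall_mem_of_isChain (fun a b h => h.2) a b t' hT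
  · rw [hl] at hw
    obtain ⟨a, -, rfl⟩ := List.mem_map.1 hw
    exact a.2

/-- FROM A MONOCHROMATIC CHAIN TO AN OPEN CROSSING: a nonempty `cellGraph x.2`-chain of black cells of `S`
is an open path of `blackEdges x` inside `S` from its first to its last cell. [folklore] -/
theorem mem_openConnIn_of_isChain {x : Obs} {S : Set (Site 2)} :
    ∀ (l : List (Site 2)) (hl : l ≠ []), List.IsChain (cellGraph x.2).Adj l → (∀ w ∈ l, w ∈ x.1) →
      (∀ w ∈ l, w ∈ S) → blackEdges x ∈ openConnIn S (l.head hl) (l.getLast hl)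
  | [], hl, _, _, _ => absurd rfl hl
  | [a], _, _, _, hS => by
    have ha : a ∈ S := hS a (by simp)
    exact ⟨ha, ha, SimpleGraph.Reachable.refl _⟩
  | a :: b :: t, _, hc, hb, hS => by
    have hab : (cellGraph x.2).Adj a b := (List.isChain_cons_cons.1 hc).1
    obtain ⟨hbS, hlS, hreach⟩ := mem_openConnIn_of_isChain (b :: t) (List.cons_ne_nil _ _)
      (List.isChain_cons_cons.1 hc).2 (fun w hw => hb w (List.mem_cons_of_mem _ hw))
      (fun w hw => hS w (List.mem_cons_of_mem _ hw))
    have haS : a ∈ S := hS a List.mem_cons_self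
    have hedge : (openGraph (blackEdges x)).Adj a b := (openGraph_adj _ _ _).2
      ⟨mk_mem_blackEdges_of_adj hab (hb a List.mem_cons_self) (hb b (by simp)), hab.ne⟩
    have hadj : ((openGraph (blackEdges x)).induce S).Adj ⟨a, haS⟩ ⟨b, hbS⟩ := hedge
    refine ⟨haS, by simpa using hlS, ?_⟩
    have := hadj.reachable.trans hreach
    simpa using this

/-! ## Metric facts: lattice steps, arcs -/

/-- Rescaled positions of `cellGraph`-neighbours are at distance `≤ 2δ`. [folklore] -/
theorem dist_pos_le_of_adj {A : Set (Site 2)} {u v : Site 2} (h : (cellGraph A).Adj u v) {δ : ℝ}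
    (hδ : 0 ≤ δ) : dist (pos δ u) (pos δ v) ≤ 2 * δ := by
  have key : ∀ a b : Site 2, (b = a + ![1, 0] ∨ b = a + ![0, 1] ∨ (b = a + ![1, 1] ∧ a ∉ A) ∨
      (b = a + ![1, -1] ∧ (a + ![0, -1]) ∈ A)) → ‖sqEmb a - sqEmb b‖ ≤ 2 := by
    rintro a b hr
    have hsub : ∀ e : Site 2, b = a + e → sqEmb a - sqEmb b = -(((e 0 : ℝ) : ℂ) + ((e 1 : ℝ) : ℂ) * Complex.I) := by
      rintro e rfl; simp only [sqEmb, Pi.add_apply, Int.cast_add]; push_cast; ring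
    rcases hr with h | h | ⟨h, -⟩ | ⟨h, -⟩ <;> rw [hsub _ h, norm_neg] <;>
      refine (Complex.norm_le_abs_re_add_abs_im _).trans ?_ <;> simp <;> norm_num
  have hsymm : ‖sqEmb u - sqEmb v‖ ≤ 2 := by
    obtain ⟨-, hr | hr⟩ := (SimpleGraph.fromRel_adj _ _ _).1 h
    · exact key u v hr
    · rw [← norm_neg, neg_sub]; exact key v u hr
  rw [dist_eq_norm, pos, pos, ← mul_sub, norm_mul, Complex.norm_real, Real.norm_eq_abs, abs_of_nonneg hδ]
  nlinarith

/-- The arcs `arc 0` and `arc 2` of a conformal rectangle are at positive distance. [folklore] -/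
theorem exists_pos_le_dist_arc_zero_two (R : ConformalRectangle) :
    ∃ d : ℝ, 0 < d ∧ ∀ p ∈ R.arc 0, ∀ q ∈ R.arc 2, d ≤ dist p q := by
  have hK : IsCompact (R.arc 0 ×ˢ R.arc 2) := (R.isCompact_arc 0).prod (R.isCompact_arc 2)
  have hne : (R.arc 0 ×ˢ R.arc 2).Nonempty := ⟨(R.pt 0, R.pt 2), R.pt_mem_arc_self 0, R.pt_mem_arc_self 2⟩
  obtain ⟨⟨p₀, q₀⟩, hpq₀, hmin⟩ :=
    hK.exists_isMinOn hne (continuous_dist.comp (continuous_fst.prodMk continuous_snd)).continuousOn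
  have hpos : 0 < dist p₀ q₀ := by
    rw [dist_pos]
    rintro rfl
    rcases R.mem_arc_inter_arc (i := 0) (k := 2) (by decide) hpq₀.1 hpq₀.2 with h | h
    · have := (R.pt_mem_arc_iff (m := 0) (i := 2)).1 (h ▸ hpq₀.2)
      rcases this with h' | h' <;> exact absurd h' (by decide)
    · have := (R.pt_mem_arc_iff (m := 0 + 1) (i := 2)).1 (h ▸ hpq₀.2)
      rcases this with h' | h' <;> exact absurd h' (by decide)
  refine ⟨dist p₀ q₀, hpos, fun p hp q hq => ?_⟩
  exact hmin (show (p, q) ∈ R.arc 0 ×ˢ R.arc 2 from ⟨hp, hq⟩)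

/-- A point at `infDist ≤ c` from an arc is within `c` of a point of the arc. [folklore] -/
theorem exists_mem_arc_dist_le (R : ConformalRectangle) (i : Fin 4) {p : ℂ} {c : ℝ}
    (h : Metric.infDist p (R.arc i) ≤ c) : ∃ q ∈ R.arc i, dist p q ≤ c := by
  obtain ⟨q, hq, hpq⟩ := (R.isCompact_arc i).exists_infDist_eq_dist ⟨R.pt i, R.pt_mem_arc_self i⟩ p
  exact ⟨q, hq, hpq ▸ h⟩

end CouplingToLimits

/-- REGISTERED SUB-GOAL `stub_CouplingToLimits_coupling` of stub `stub_CouplingToLimits` (the coupling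
inequality `CouplingToLimits.real_le_of_coupling_fst`). [folklore] -/
theorem stub_CouplingToLimits_coupling :
    ∀ {γ : Measure (Ω × Ω)}, γ.map Prod.fst = μIK → γ.map Prod.snd = μIK →
      ∀ {B : Set (Ω × Ω)} {ε : ℝ}, 0 ≤ ε → γ B ≤ ENNReal.ofReal ε →
      ∀ {E F : Set Ω}, MeasurableSet E → (∀ p : Ω × Ω, p.1 ∈ E → p ∉ B → p.2 ∈ F) →
      μIK.real E ≤ ε + μIK.real F :=
  fun h1 h2 _ _ hε hB _ _ hE hincl => CouplingToLimits.real_le_of_coupling_fst h1 h2 hε hB hE hincl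

end Summit.CriticalPhenomena.CardyFormulaZ2.Theorems.IKLinearTransport.PinnedDiagramExchange

end
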